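/-
Copyright (c) 2026. All rights reserved.
Released under Apache 2.0 license as described in the file LICENSE.
Authors: abc-iut cell, campaign-S prover seat abc-iut-S8 (wave 2).
-/
import Literature.IUT.LogVolume.LogVolumeEstimatesFirst
import Literature.IUT.LogVolume.LogVolumeEstimatesMoreover
import Literature.IUT.LogVolume.TensorPacketLogHolds
import HarnessLib

/-!
# [IUTchIV] Prop. 1.4 (iii) — proved (assembly)

With the inclusions of (iii) (= Prop. 1.2 (ii), `prop12ii_holds`) and the inclusion clause of (iv)
(= Prop. 1.2 (iv), `prop12iv_holds`) discharged by the Prop. 1.1/1.2 companions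
(`TensorPacketLogHolds.lean`, abc-iut-S6 over abc-iut-S5's `prop11_holds`), the two displayed
inequalities (`Prop14iii₁_holds`, `Prop14iii₂_holds`) and "Moreover" (`Prop14iii₃_holds`) proved by
abc-iut-S8 (over abc-iut-S7's intrinsic Haar measure for the first inequality), [IUTchIV] Prop. 1.4
(iii) (kurims p. 13) holds as typed: `Prop14iii_holds` (part (iv): `LogVolumeEstimatesFourth.lean`).
Nothing here bears on the disputed [IUTchIII] Cor. 3.12.
-/

noncomputable section

namespace Literature.IUT.LogVolume

variable (p : ℕ) [Fact p.Prime]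
variable {I : Type} [Fintype I] [DecidableEq I]
variable (k : I → Type) [∀ i, NontriviallyNormedField (k i)] [∀ i, NormedAlgebra ℚ_[p] (k i)]
  [∀ i, IsUltrametricDist (k i)] [∀ i, ProperSpace (k i)]
variable {J : Type} [Fintype J] (L : J → Type) [∀ j, NontriviallyNormedField (L j)]
  [∀ j, NormedAlgebra ℚ_[p] (L j)] [∀ j, IsUltrametricDist (L j)] [∀ j, ProperSpace (L j)]
  [∀ j, MeasurableSpace (L j)] [∀ j, BorelSpace (L j)]
variable (ψ : PacketAlgebra p k ≃ₐ[ℚ_[p]] (Π j, L j))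

/-- **[IUTchIV] Prop. 1.4 (iii) holds** in full: inclusions, both displayed inequalities, "Moreover".
[cite: Mochizuki2012, IUTchIV Prop. 1.4 (iii) p. 13] -/
theorem Prop14iii_holds : Prop14iii p k L ψ :=
  ⟨prop12ii_holds p k, Prop14iii₁_holds p k L ψ, Prop14iii₂_holds p k L ψ, Prop14iii₃_holds p k⟩

end Literature.IUT.LogVolume

end
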